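import Summits.Langlands.Langlands.Theses.ExteriorSquareAscent
import Summits.Langlands.Langlands.Theorems.QuadraticWindowBeyondTheWindowSummitImpliesWindow
import Summits.Langlands.Langlands.Theorems.IrreducibilityBySelfDualityIrreducibleOffSectorTransfer
import Summits.Langlands.Langlands.Theorems.IrreducibilityBySelfDualityHLTTCor627SplitOrUnramifiedOfThmA
import Summits.Langlands.Langlands.Theorems.QuadraticImprimitiveSurfaces.Negative.HypothesisAnatomy

/-!
# Disproof of `RestOfReciprocity` (stmt-Langlands-18056, route ExteriorSquareAscent) — findings

Standing disprover's work file (cdisprove gen 1, cycle 1, 2026-08-17,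
refuter-cdisprove-stmt-Langlands-18056-0).  Crux: `RestOfReciprocity := IrreducibleGL4 → Langlands`
(the route's declared open component, rank 5; X = `IrreducibleGL4` is the route's target).
Everything below is sorry-free and kernel-checked unless marked NEAR-MISS.

VERDICT: **no kill; the crux cannot be refuted short of refuting the audited summit AND proving the
route's open target.**  Findings, each a theorem of this file:

* §0 truth table — `not_restOfReciprocity_iff : ¬ C ↔ X ∧ ¬ Langlands`,
  `restOfReciprocity_iff_not_or : C ↔ ¬ X ∨ Langlands`; `C` is provable only by proving the summit
  or refuting X, refutable only in the world "X true, summit false".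
* §1 load-bearing analysis — the crux has ONE hypothesis, X.  `RestOfReciprocityWithoutX` is
  literally `Langlands`; `restOfReciprocity_false_without_X` would be `¬ Langlands` and is NOT
  claimed (it would refute the audited summit `Summits/Langlands/Langlands/Statement.lean`).  So the
  usual "any proof must use H" certificate is unavailable BY DESIGN: dropping X turns the crux into
  the summit, and X costs exactly X (§2).
* §2 containment — **the hypothesis is a corollary of the conclusion**:
  `irreducibleGL4_of_langlands : Langlands → IrreducibleGL4` (re-derived here, kernel-checked; the
  vetting refuter's `LanglandsImpliesX.lean` is item evidence only).  Route: clause (A) of the summit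
  for the cuspidal L-algebraic twist `π ⊗ |det|^{-3/2}` of the C-algebraic `π`
  (`exists_galoisRep_satakeC_of_langlands`, any rank `n ≥ 1`: Buzzard–Gee §5.3 twist
  `CuspidalAutomorphicRepData.exists_twist_hasInfinityType`, Satake transport
  `eventually_hasSatakeParamAt_of_map_mulChar_detTwist`, Flath uniqueness, and the normalisation
  identity `arithFrobPolyOfSatake ι q 1 ((√q)^{n-1} α) = arithFrobPolyOfSatake ι q n α`), then the
  Chebotarev–Brauer–Nesbitt transfer `isIrreducible_of_eventually_hasFrobCharpolyAt_common`.
  NONE of X's sector hypotheses (Hecke field, not essentially self-dual, `ρ` semisimple, the GL₁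
  compactness fact `h1`) is used: `irreducibleGL4Plus_of_langlands` proves the hypothesis-free
  `IrreducibleGL4Plus ⊇ X`.  Consequences: `langlands_iff_irreducibleGL4_and_restOfReciprocity`
  (target + rest = summit exactly), `not_langlands_iff` (`¬ Langlands ↔ ¬ X ∨ ¬ C`),
  `restOfReciprocity_iff_irreducibleGL4_iff_langlands` (`C ↔ (X ↔ Langlands)`),
  `imp_langlands_iff_imp_restOfReciprocity` (C is the WEAKEST residual closing the glue
  `X → B → Langlands`), and `not_restOfReciprocity_iff'` (`¬ C ↔ X ∧ ¬ Langlands`, with X now known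
  to be a summit corollary: a disproof = Shavali's Thm A over all number fields incl. CM, PLUS a
  counterexample to Buzzard–Gee 3.2.1/3.2.2 or Fontaine–Mazur as typed).
* §3 the cheapest counterexample SHAPE to X (= cheapest proof of C, ex falso) is pinned to the
  automorphic interface: the trivial avatar `𝟙₄` is semisimple, reducible, unramified with
  `charpoly = (X-1)⁴` everywhere (tree lemmas `isSemisimple_one`, `not_isIrreducible_one`), so
  `irreducibleGL4_forbids_trivial_shadow`: X ⊢ no sector `π` has `arithFrobPolyOfSatake ι q_v 4 α_v
  = (X-1)⁴` a.e. (Satake parameter `{q_v^{-3/2}}⁴`).  `CuspidalAutomorphicRepData 4 K hcpt` is an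
  honest interface (`W ≤ 𝒜₀(GL₄)`, genuine Hecke operators; no tree inhabitant, Disproof §3 note), so
  neither X nor ¬X is reachable by junk; Jacquet–Shalika (not formalised) excludes the shape in nature.
* Attacks that do not apply (recorded so nobody repeats them): degenerate parameters (the crux is a
  closed implication between two closed Props — no `n = 0`, empty family or junk field to
  instantiate); decide/small models (nothing finite); barrier reductions (the 12 catalogued
  `Literature/Barriers/Langlands/*` concern proof techniques for reciprocity, not the truth value of
  `X → Langlands`); negatives index (`ledger negatives --problem Langlands`: no entry restated here);
  summit-side typing artefacts on the pair (`π_𝟙`, `ρ = 1`) — already mined by the sibling disprover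
  of `ReciprocityUpToIrreducibility` (`Theorems/ReciprocityUpToIrreducibility/Negative/*`, which led
  to the (F8) re-type of `IsFontaineDatum`); they would in any case give `¬ Langlands`, never X.

HANDOFF for provers/planners: do not staff C; `C ∧ X ↔ Langlands`; the only honest progress on C is
progress on the summit's other components (birth skeleton `Lines/birth.lean`: N / W / B_w / LGC /
Irr(n ≠ 4)), and X is inert there (NOTES-r1-k2 §1).

LANDED / CROSS-REFERENCES (2026-08-17): the lead's `Theorems/ExteriorSquareAscentRestOfReciprocityOfR.lean`
(landed 12:05Z, independently of this file) has `irreducibleGL4_of_langlands`,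
`langlands_iff_irreducibleGL4_and_restOfReciprocity`, `not_restOfReciprocity_iff` and the sandwich
`C ↔ (X → R)` under JS (2.2)–(2.3), R = text of stmt-Langlands-17925 (lead outcome `blocked-on:
stmt-Langlands-17925`).  This disprover's negative-lane file
`Theorems/RestOfReciprocity/Negative/ExteriorSquareAscentPosition.lean` (proposal p160877) adds the
GENERAL-RANK lemmas `exists_galoisRep_satakeC_of_langlands` / `not_langlands_of_not_isIrreducible_compatibleC`
(a reducible C-compatible avatar of a C-algebraic cuspidal `π` on `GL_n`, any `n ≥ 1`, any number
field, refutes the summit), `¬ Langlands ↔ ¬ X ∨ ¬ C`, the truth table, `C ↔ (X ↔ Langlands)` and the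
weakest-residual lemma.  §2 below is this file's self-contained derivation (kept so the work file
checks without the landed modules' namespaces).
-/

set_option linter.dupNamespace false

noncomputable section

namespace Summit.Langlands.Langlands.Cruxes.RestOfReciprocity.Disproof

open Summit.Langlands.Langlands.Theses.ExteriorSquareAscent
open Literature.NumberTheory.Automorphic Literature.NumberTheory.GaloisRepresentations
open NumberField IsDedekindDomain Filter
open Summit.Langlands.Langlands.Theorems.QuadraticWindowResidual
  (isLAlgebraic_twist_neg_half_of_isCAlgebraic cpow_neg_half_inv_eq_sqrt_pow
    arithFrobPolyOfSatake_one_map_sqrt_pow)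
open Summit.Langlands.Langlands.Theorems.IrreducibleOffSector
  (isIrreducible_of_eventually_hasFrobCharpolyAt_common)

/-! ## §0 Truth table of the frame `C := X → Langlands` -/

/-- The crux, unfolded. [folklore] -/
theorem restOfReciprocity_iff : RestOfReciprocity ↔ (IrreducibleGL4 → _root_.Langlands) := Iff.rfl

/-- Exact content of a refutation: `¬ C ↔ X ∧ ¬ Langlands`. [folklore] -/
theorem not_restOfReciprocity_iff : ¬ RestOfReciprocity ↔ IrreducibleGL4 ∧ ¬ _root_.Langlands :=
  Classical.not_imp

/-- Truth table: `C ↔ ¬ X ∨ Langlands`. [folklore] -/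
theorem restOfReciprocity_iff_not_or : RestOfReciprocity ↔ ¬ IrreducibleGL4 ∨ _root_.Langlands :=
  imp_iff_not_or

/-- The summit proves the crux (weakening). [folklore] -/
theorem restOfReciprocity_of_langlands (h : _root_.Langlands) : RestOfReciprocity := fun _ => h

/-- A refutation of the target proves the crux (ex falso) — the "cheap closure" a disprover of X
would hand the route, and the reason kill criterion (1) of the route flags the summit. [folklore] -/
theorem restOfReciprocity_of_not_irreducibleGL4 (h : ¬ IrreducibleGL4) : RestOfReciprocity :=
  fun hX => absurd hX h

/-! ## §1 Load-bearing analysis: the crux with its only hypothesis dropped IS the summit -/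

/-- `C` with the hypothesis X dropped. [folklore] -/
def RestOfReciprocityWithoutX : Prop := _root_.Langlands

/-- … is literally the summit statement; `¬ RestOfReciprocityWithoutX` (the would-be
`restOfReciprocity_false_without_X`) is `¬ Langlands` and is not claimed. [folklore] -/
theorem restOfReciprocityWithoutX_iff : RestOfReciprocityWithoutX ↔ _root_.Langlands := Iff.rfl

/-- The would-be load-bearing certificate is equivalent to refuting the summit. [folklore] -/
theorem not_restOfReciprocityWithoutX_iff : ¬ RestOfReciprocityWithoutX ↔ ¬ _root_.Langlands :=
  Iff.rfl

/-- Dropping X strengthens the crux (trivially). [folklore] -/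
theorem restOfReciprocity_of_withoutX (h : RestOfReciprocityWithoutX) : RestOfReciprocity :=
  fun _ => h

/-! ## §2 Containment: `Langlands → X`, so target and rest are EXACTLY the summit -/

/-- **The summit implies the C-normalised Satake clause for every C-algebraic cuspidal `π` of
`GL_n(𝔸_F)`, every number field `F`, every `n ≥ 1`** (the regular-algebraic version is
`QuadraticWindowResidual.exists_galoisRep_satake_of_langlands`; only C-algebraicity is used).
There is an irreducible `ρ : Γ_F → GL_n(ℚ̄_ℓ)` with `charpoly ρ(Frob_w) = arithFrobPolyOfSatake ι
q_w n α` for every Satake parameter `α` of `π` at almost every `w`.  Proof: conjunct (A) of the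
summit for the cuspidal L-algebraic twist `π ⊗ |det|^{(1-n)/2}` (Buzzard–Gee 2014 §5.3), Satake
transport under the twist (Arthur–Clozel), Flath uniqueness, normalisation bookkeeping.
[cite: BuzzardGeeLMS2014, Conj. 3.2.1 and §5.3] -/
theorem exists_galoisRep_satakeC_of_langlands (hL : _root_.Langlands) {F : Type} [Field F]
    [NumberField F] {n : ℕ} (hn : 0 < n) (hcpt : isCompact_glFiniteIntegralLevel n F)
    (π : CuspidalAutomorphicRepData n F hcpt) (hC : π.1.IsCAlgebraic) (ℓ : ℕ) [Fact ℓ.Prime]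
    (ι : PadicAlgCl ℓ ≃+* ℂ) :
    ∃ ρ : FramedGaloisRep F (PadicAlgCl ℓ) n, ρ.toGaloisRep.IsIrreducible ∧
      ∀ᶠ w : HeightOneSpectrum (𝓞 F) in cofinite, ∀ α : Multiset ℂ, π.1.HasSatakeParamAt w α →
        ρ.IsUnramifiedAt w ∧ ρ.HasFrobCharpolyAt w (arithFrobPolyOfSatake ι w.residueCard n α) := by
  haveI : NeZero n := ⟨hn.ne'⟩
  obtain ⟨T, hT, hCT⟩ := hC
  obtain ⟨χ, π', hχ, hW, hW', hT'⟩ := π.exists_twist_hasInfinityType (-(((n : ℝ) - 1) / 2)) hT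
  have hLalg : π'.1.IsLAlgebraic := by
    refine ⟨_, hT', ?_⟩
    have e : (((-(((n : ℝ) - 1) / 2) : ℝ)) : ℂ) = -(((n : ℂ) - 1) / 2) := by push_cast; ring
    rw [e]
    exact isLAlgebraic_twist_neg_half_of_isCAlgebraic hCT
  obtain ⟨⟨𝓡⟩, h𝓡⟩ := hL F
  obtain ⟨ρ, hirr, -, hcorr, -⟩ := (h𝓡 𝓡 n hn hcpt).1 π' hLalg ℓ ι
  refine ⟨ρ, hirr, ?_⟩
  have hsat := AutomorphicRepData.eventually_hasSatakeParamAt_of_map_mulChar_detTwist χ hW hW'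
  filter_upwards [hsat, hcorr.1] with w hw hc α hα
  obtain ⟨α', hα', hur, hch⟩ := hc
  refine ⟨hur, ?_⟩
  have heq : α' = α.map (χ.valueAtUniformizer w * ·) :=
    π'.1.hasSatakeParamAt_unique_holds hα' (hw α hα)
  rw [heq, Literature.NumberTheory.Automorphic.HeckeCharacter.valueAtUniformizer_of_cpow hχ w,
    cpow_neg_half_inv_eq_sqrt_pow _ hn, arithFrobPolyOfSatake_one_map_sqrt_pow] at hch
  exact hch

/-- **X with every sector hypothesis deleted** (no Hecke field, essential self-duality allowed,
`ρ` not assumed semisimple, no GL₁ compactness fact): every `ρ : Γ_K → GL₄(ℚ̄_ℓ)` C-compatible a.e.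
with a cuspidal C-algebraic `π` on `GL₄(𝔸_K)` is irreducible. [folklore] -/
def IrreducibleGL4Plus : Prop :=
  ∀ (K : Type) [Field K] [NumberField K] (hcpt : isCompact_glFiniteIntegralLevel 4 K)
    (π : CuspidalAutomorphicRepData 4 K hcpt), π.1.IsCAlgebraic →
    ∀ (ℓ : ℕ) [Fact ℓ.Prime] (ι : PadicAlgCl ℓ ≃+* ℂ) (ρ : FramedGaloisRep K (PadicAlgCl ℓ) 4),
      (∀ᶠ v : HeightOneSpectrum (𝓞 K) in cofinite, ∃ α : Multiset ℂ, π.1.HasSatakeParamAt v α ∧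
        ρ.IsUnramifiedAt v ∧ ρ.HasFrobCharpolyAt v (arithFrobPolyOfSatake ι v.residueCard 4 α)) →
      ρ.toGaloisRep.IsIrreducible

/-- `IrreducibleGL4Plus → IrreducibleGL4` (X is the Plus statement restricted to the sector and to
semisimple `ρ`). [folklore] -/
theorem irreducibleGL4_of_plus (h : IrreducibleGL4Plus) : IrreducibleGL4 :=
  fun K _ _ _h1 hcpt π hC _hE _hNE ℓ _ ι ρ _hss hρ => h K hcpt π hC ℓ ι ρ hρ

/-- **The summit implies the hypothesis-free X.** Clause (A) for the L-algebraic twist gives an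
irreducible avatar `ρ₀` with the C-normalised polynomials a.e. (`exists_galoisRep_satakeC_of_langlands`);
any `ρ` compatible a.e. shares them (the `∀ α` clause of `ρ₀` meets the `∃ α` clause of `ρ`), so
`ρ` is irreducible by Chebotarev–Brauer–Nesbitt (`isIrreducible_of_eventually_hasFrobCharpolyAt_common`,
no semisimplicity of `ρ` needed). [folklore] -/
theorem irreducibleGL4Plus_of_langlands (hL : _root_.Langlands) : IrreducibleGL4Plus := by
  intro K _ _ hcpt π hC ℓ _ ι ρ hρ
  obtain ⟨ρ₀, hirr₀, h₀⟩ := exists_galoisRep_satakeC_of_langlands hL four_pos hcpt π hC ℓ ι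
  refine isIrreducible_of_eventually_hasFrobCharpolyAt_common hirr₀ ?_
  filter_upwards [h₀, hρ] with v hv hv'
  obtain ⟨α, hα, hur, hcp⟩ := hv'
  obtain ⟨hur₀, hcp₀⟩ := hv α hα
  exact ⟨hur₀, hur, _, hcp₀, hcp⟩

/-- **`Langlands → IrreducibleGL4`**: the crux's hypothesis is a corollary of its conclusion; none
of X's sector hypotheses is used. [folklore] -/
theorem irreducibleGL4_of_langlands (hL : _root_.Langlands) : IrreducibleGL4 :=
  irreducibleGL4_of_plus (irreducibleGL4Plus_of_langlands hL)

/-- Contrapositive (the negative-lane form): a counterexample to the route's target refutes the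
summit as typed. [folklore] -/
theorem not_langlands_of_not_irreducibleGL4 (hX : ¬ IrreducibleGL4) : ¬ _root_.Langlands :=
  fun hL => hX (irreducibleGL4_of_langlands hL)

/-- **Target and rest together are exactly the summit.** [folklore] -/
theorem langlands_iff_irreducibleGL4_and_restOfReciprocity :
    _root_.Langlands ↔ IrreducibleGL4 ∧ RestOfReciprocity :=
  ⟨fun hL => ⟨irreducibleGL4_of_langlands hL, fun _ => hL⟩, fun h => h.2 h.1⟩

/-- Negative truth table of the summit along the route's cut: the summit fails iff the target fails
or the rest fails. [folklore] -/
theorem not_langlands_iff : ¬ _root_.Langlands ↔ ¬ IrreducibleGL4 ∨ ¬ RestOfReciprocity := by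
  rw [langlands_iff_irreducibleGL4_and_restOfReciprocity, not_and_or]

/-- The crux is the bi-implication "target ↔ summit". [folklore] -/
theorem restOfReciprocity_iff_irreducibleGL4_iff_langlands :
    RestOfReciprocity ↔ (IrreducibleGL4 ↔ _root_.Langlands) :=
  ⟨fun h => ⟨h, irreducibleGL4_of_langlands⟩, fun h => h.1⟩

/-- **The crux is the weakest possible residual**: `B` closes the glue `X → B → Langlands` iff
`B → RestOfReciprocity`; no restatement of stmt-Langlands-18056 is both adequate and easier.
[folklore] -/
theorem imp_langlands_iff_imp_restOfReciprocity (B : Prop) :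
    (IrreducibleGL4 → B → _root_.Langlands) ↔ (B → RestOfReciprocity) :=
  ⟨fun h hB hX => h hX hB, fun h hX hB => h hB hX⟩

/-- Refutation content revisited: a disproof of the crux is a proof of X (Shavali's Thm A over every
number field, the CM case included) together with a refutation of the audited summit; and since
`Langlands → X`, the second half alone decides everything: `¬ C ↔ X ∧ ¬ Langlands` with
`¬ X → ¬ Langlands`. [folklore] -/
theorem not_restOfReciprocity_iff' :
    ¬ RestOfReciprocity ↔ IrreducibleGL4 ∧ ¬ _root_.Langlands ∧ ¬ RestOfReciprocity :=
  ⟨fun h => ⟨(not_restOfReciprocity_iff.mp h).1, (not_restOfReciprocity_iff.mp h).2, h⟩,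
    fun h => h.2.2⟩

/-! ## §3 The cheapest counterexample shape to X lives on the automorphic interface -/

/-- The trivial rank-4 avatar `𝟙₄ : Γ_K → GL₄(ℚ̄_ℓ)` is semisimple … (tree:
`HLTTCor627SplitOrUnramified.isSemisimple_one`). [folklore] -/
theorem isSemisimple_trivial (K : Type) [Field K] (ℓ : ℕ) [Fact ℓ.Prime] :
    (1 : FramedGaloisRep K (PadicAlgCl ℓ) 4).toGaloisRep.IsSemisimple :=
  Summit.Langlands.Langlands.Theorems.HLTTCor627SplitOrUnramified.isSemisimple_one

/-- … and reducible (tree: `QuadraticImprimitiveSurfaces.Negative.not_isIrreducible_one`). [folklore] -/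
theorem not_isIrreducible_trivial (K : Type) [Field K] (ℓ : ℕ) [Fact ℓ.Prime] :
    ¬ (1 : FramedGaloisRep K (PadicAlgCl ℓ) 4).toGaloisRep.IsIrreducible :=
  Summit.Langlands.Langlands.Theorems.QuadraticImprimitiveSurfaces.Negative.not_isIrreducible_one ℓ

/-- **X forbids the trivial shadow.**  Under X, no cuspidal C-algebraic `π` on `GL₄(𝔸_K)` with a
Hecke field and not essentially self-dual at Satake level is C-compatible a.e. with `𝟙₄`, i.e. has
`arithFrobPolyOfSatake ι q_v 4 α_v = (X - 1)⁴` (Satake parameter `{q_v^{-3/2}}⁴`) at almost all `v`.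
This is the cheapest conceivable counterexample to X (hence the cheapest proof of the crux, ex
falso): it needs an inhabitant of the HONEST interface `CuspidalAutomorphicRepData 4 K hcpt`
(`W ≤ 𝒜₀`, genuine Hecke eigenvalues), of which the tree has none; in nature Jacquet–Shalika's
classification excludes it (`π` would be nearly equivalent to `|det|^{-3/2} ⊗ (1 ⊞ 1 ⊞ 1 ⊞ 1)`).
[cite: JacquetShalikaAJM1981II, Thm. 4.4] -/
theorem irreducibleGL4_forbids_trivial_shadow (hX : IrreducibleGL4) (K : Type) [Field K]
    [NumberField K] (h1 : isCompact_glFiniteIntegralLevel 1 K)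
    (hcpt : isCompact_glFiniteIntegralLevel 4 K) (π : CuspidalAutomorphicRepData 4 K hcpt)
    (hC : π.1.IsCAlgebraic)
    (hE : ∃ E : Subfield ℂ, FiniteDimensional ℚ E ∧ ∀ᶠ v in cofinite, ∀ α : Multiset ℂ,
      π.1.HasSatakeParamAt v α → ∀ i ≤ 4,
        ((((Real.sqrt (v.residueCard : ℝ)) : ℝ) : ℂ) ^ (i * (4 - i))) * α.esymm i ∈ E)
    (hNE : ¬ (∃ η : CuspidalAutomorphicRepData 1 K h1, ∀ᶠ v in cofinite, ∀ α : Multiset ℂ,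
      π.1.HasSatakeParamAt v α → ∃ e : ℂ, η.1.HasSatakeParamAt v {e} ∧
        α.map (fun a => a⁻¹) = α.map (fun a => e * a)))
    (ℓ : ℕ) [Fact ℓ.Prime] (ι : PadicAlgCl ℓ ≃+* ℂ) :
    ¬ ∀ᶠ v : HeightOneSpectrum (𝓞 K) in cofinite, ∃ α : Multiset ℂ, π.1.HasSatakeParamAt v α ∧
      (1 : FramedGaloisRep K (PadicAlgCl ℓ) 4).IsUnramifiedAt v ∧
      (1 : FramedGaloisRep K (PadicAlgCl ℓ) 4).HasFrobCharpolyAt v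
        (arithFrobPolyOfSatake ι v.residueCard 4 α) :=
  fun h => not_isIrreducible_trivial K ℓ (hX K h1 hcpt π hC hE hNE ℓ ι 1 (isSemisimple_trivial K ℓ) h)

/-- Same statement under the summit instead of X (through §2): the shape would refute `Langlands`
itself. [folklore] -/
theorem langlands_forbids_trivial_shadow (hL : _root_.Langlands) (K : Type) [Field K]
    [NumberField K] (hcpt : isCompact_glFiniteIntegralLevel 4 K)
    (π : CuspidalAutomorphicRepData 4 K hcpt) (hC : π.1.IsCAlgebraic)
    (ℓ : ℕ) [Fact ℓ.Prime] (ι : PadicAlgCl ℓ ≃+* ℂ) :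
    ¬ ∀ᶠ v : HeightOneSpectrum (𝓞 K) in cofinite, ∃ α : Multiset ℂ, π.1.HasSatakeParamAt v α ∧
      (1 : FramedGaloisRep K (PadicAlgCl ℓ) 4).IsUnramifiedAt v ∧
      (1 : FramedGaloisRep K (PadicAlgCl ℓ) 4).HasFrobCharpolyAt v
        (arithFrobPolyOfSatake ι v.residueCard 4 α) :=
  fun h => not_isIrreducible_trivial K ℓ (irreducibleGL4Plus_of_langlands hL K hcpt π hC ℓ ι 1 h)

end Summit.Langlands.Langlands.Cruxes.RestOfReciprocity.Disproof

end
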